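import Literature.NumberTheory.EllipticCurves.RationalIsogenyDegreesProofs
import Literature.NumberTheory.EllipticCurves.PointDivisibilityProofs
import Literature.NumberTheory.EllipticCurves.Szpiro
import HarnessLib

/-!
# Full rational `2`-torsion excludes rational `p`-isogenies, `p ≥ 5` (Darmon–Merel 1997, Thm. 2.2)

Literature / elliptic curves. A *proofs* file (theorems only: no definitions, no named facts) on
top of the tree's isogeny library (`Isogeny`, `IsogenyQuotientCurveProofs`, `IsogenyDualProofs`,
`IsogenyNotRationalCMProofs`, `RationalIsogenyDegreesProofs`, `PointDivisibilityProofs`) and of the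
named fact `Literature.NumberTheory.EllipticCurves.mazurKenku_exists_cyclic_isogeny` (Mazur 1978,
Thm. 1 with Kenku 1982: the degrees of cyclic `ℚ`-isogenies, taken as a hypothesis `hMK`).

Darmon–Merel, *Winding quotients and some variants of Fermat's Last Theorem*, J. reine angew. Math.
490 (1997) 81–100, prove in §2, Theorem 2.2 ("The representation `ρ` is absolutely irreducible"),
that for their Frey curves `E : y² = x(x − aᵖ)(x − 2cᵖ)` (which have "all [their] points of order
`2` defined over `ℚ`", Lemma 1.2 (1)) the mod `p` representation `ρ : G_ℚ → Aut(E[p])`, `p ≥ 7`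
prime, is irreducible; printed proof (p. 8 of the 26-page version): "When `p ≥ 17`, this is a direct
consequence of the results of Mazur [18], since the curve `E` has at least one odd prime of
multiplicative reduction. If `7 ≤ p ≤ 13` and `ρ` is reducible, then the curve `E` gives rise (by
lemma 1.2) to a rational point on one of the modular curves `X₀(N)` with `N = 14, 22, 26, 21, 33`,
or `39`. These rational points are known to be either cuspidal, or CM" (Mazur [18], Kubert [16],
Kenku [14]). This file proves the statement by a DIFFERENT, uniform road — through `X₀(4p)` rather
than `X₀(2p)`, `X₀(3p)` and integrality of `j` — for **every** elliptic curve over `ℚ` with full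
rational `2`-torsion and every prime `p ≥ 5`, from the single tree fact
`mazurKenku_exists_cyclic_isogeny` (the Mazur–Kenku classification of rational cyclic isogenies,
which packages exactly the cited results on `X₀(N)(ℚ)`): a `Γ_ℚ`-stable line `C ⊂ E[p]` together
with the rational `2`-torsion produces, on the `2`-isogenous curve `E₁ = E/⟨Q⟩`, a `Γ_ℚ`-stable
**cyclic** subgroup of order `4p` (generated by the images of a half `R` of a second `2`-torsion
point `P` and of a generator of `C`), i.e. a rational cyclic `4p`-isogeny `E₁ → E₂`; but `4p ≥ 20`
divides no degree in Kenku's list `{1, …, 19, 21, 25, 27, 37, 43, 67, 163}`. In the tree's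
(existential) form of the Mazur–Kenku fact the last step reads: the fact supplies a cyclic `ψ : E₁ →
E₂` of degree `m ∈ kenkuDegrees`; `f₂ ∘ ψ ∈ End_ℚ(E₁) = ℤ` (`not_hasRationalCM_holds`) is some
`[n]`, and counting kernels gives `4 p m = n²`, which inside Kenku's list forces `m = p`, `n = ±2p`;
then `g₂ ∘ [n] = ψ ∘ [4p]` (their difference is killed by `f₂`, and a homomorphism from the
divisible group `E₁(ℚ̄)` into the finite group `ker f₂` vanishes), so `E₁[2] ⊆ ker g₂`, a cyclic
group — absurd.

## Contents (all proved)

* `AddMonoidHom.eq_zero_of_forall_mem_of_zsmul_surjective` — a homomorphism from a group divisible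
  by `#F` into a finite subgroup `F` is zero (group theory).
* `WeierstrassCurve.eq_zero_or_eq_or_eq_add_of_two_nsmul_eq_zero` — `E[2] = {O, P, Q, P + Q}` for
  independent `P, Q ∈ E[2]` (characteristic `≠ 2`; from `#E[2] = 4`, *AEC* III.6.4(b)).
* `Literature.NumberTheory.EllipticCurves.eq_of_mem_kenkuDegrees_of_four_mul_prime_mul_eq_sq` — the
  arithmetic of Kenku's list: `m ∈ kenkuDegrees`, `p ≥ 5` prime, `4 p m = N²` force `m = p`,
  `N = 2p`.
* **`hasIrreducibleModPGaloisRep_of_rational_two_torsion_of_mazurKenku`** — THE THEOREM: granted the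
  Mazur–Kenku fact, an elliptic curve over `ℚ` whose `2`-torsion points are all `Γ_ℚ`-fixed has
  irreducible `ρ̄_{E,p}` for every prime `p ≥ 5`.
* `hasIrreducibleModPGaloisRep_freyCurve_of_mazurKenku` — in particular for every Frey–Hellegouarch
  curve `y² = x(x − A)(x + B)`, `A B (A + B) ≠ 0` (Darmon–Merel Thm. 2.2 covers their curves (4),
  `A = aᵖ`, `B = −2cᵖ`, for `p ≥ 7`).

## References

* H. Darmon, L. Merel, J. reine angew. Math. 490 (1997) 81–100, Lemma 1.2 (1) and Thm. 2.2.
  [DarmonMerel1997]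
* B. Mazur, *Rational isogenies of prime degree*, Invent. Math. 44 (1978) 129–162, Thm. 1
  [Mazur1978]; M. A. Kenku, J. Number Theory 15 (1982) 199–202 [Kenku1982]; J. H. Silverman,
  *The Arithmetic of Elliptic Curves*, GTM 106 (2009), IX.6 Example 6.4, Cor. III.6.4(b)
  [SilvermanAEC2009].

Design: general lemmas are deliberate dot-notation extensions in `namespace AddMonoidHom` /
`namespace WeierstrassCurve`; the `ℚ`-statements live in `Literature.NumberTheory.EllipticCurves`.
No definitions, no named facts (the Mazur–Kenku fact enters as the hypothesis `hMK`).
-/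

noncomputable section

open scoped Classical

universe u

/-! ### A homomorphism from a divisible group into a finite group is zero -/

namespace AddMonoidHom

/-- If `h : A → B` takes values in a finite subgroup `F` and multiplication by `#F` is onto on `A`,
then `h = 0`: `h (#F • a) = #F • h a = 0`. (Deliberate dot-notation extension of Mathlib's
`AddMonoidHom`.) [folklore] -/
theorem eq_zero_of_forall_mem_of_zsmul_surjective {A B : Type*} [AddCommGroup A] [AddCommGroup B]
    (h : A →+ B) (F : AddSubgroup B) (hF : ∀ a, h a ∈ F)
    (hdiv : Function.Surjective fun a : A => (Nat.card F : ℤ) • a) : h = 0 := by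
  ext a
  obtain ⟨a', rfl⟩ := hdiv a
  have h0 : Nat.card F • (⟨h a', hF a'⟩ : F) = 0 := card_nsmul_eq_zero'
  have h0' := congrArg Subtype.val h0
  rw [AddSubmonoidClass.coe_nsmul] at h0'
  rw [zero_apply]
  change h ((Nat.card F : ℤ) • a') = 0
  rw [map_zsmul, natCast_zsmul]
  exact h0'

end AddMonoidHom

namespace WeierstrassCurve

open Literature.NumberTheory.EllipticCurves

variable {K : Type u} [Field K] (W : WeierstrassCurve K) [W.IsElliptic]

/-! ### `E[2] = {O, P, Q, P + Q}` -/

/-- **The `2`-torsion of an elliptic curve is `{O, P, Q, P + Q}`** for any two distinct non-zero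
points `P, Q` of order `2` (characteristic `≠ 2`): `#E[2] = 4` (Silverman, *AEC*, Cor. III.6.4(b),
the tree's `natCard_geomTorsion_eq_sq`) and `O, P, Q, P + Q` are four distinct points of `E[2]`.
(Deliberate dot-notation extension in `namespace WeierstrassCurve`.)
[cite: SilvermanAEC2009, Cor. III.6.4(b)] -/
theorem eq_zero_or_eq_or_eq_add_of_two_nsmul_eq_zero (h2 : (2 : K) ≠ 0) {P Q : W.geomPoints}
    (hP : 2 • P = 0) (hQ : 2 • Q = 0) (hP0 : P ≠ 0) (hQ0 : Q ≠ 0) (hPQ : P ≠ Q) {T : W.geomPoints}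
    (hT : 2 • T = 0) : T = 0 ∨ T = P ∨ T = Q ∨ T = P + Q := by
  have h2K : ((2 : ℕ) : K) ≠ 0 := by exact_mod_cast h2
  haveI : Finite (geomTorsion W ((2 : ℕ) : ℤ)) := finite_geomTorsion_natCast W two_ne_zero
  haveI : Fintype (geomTorsion W ((2 : ℕ) : ℤ)) := Fintype.ofFinite _
  have hmem : ∀ {X : W.geomPoints}, 2 • X = 0 → X ∈ geomTorsion W ((2 : ℕ) : ℤ) := fun hX ↦
    AddSubgroup.torsionBy.nsmul_iff.2 hX
  -- `-Q = Q`, `-P = P`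
  have hnegQ : -Q = Q := by
    rw [neg_eq_iff_add_eq_zero, ← two_nsmul]; exact hQ
  have hPQ0 : P + Q ≠ 0 := fun h ↦ hPQ (by rw [add_eq_zero_iff_eq_neg, hnegQ] at h; exact h)
  have hPQP : P + Q ≠ P := fun h ↦ hQ0 (by simpa using h)
  have hPQQ : P + Q ≠ Q := fun h ↦ hP0 (by simpa using h)
  -- the four points as elements of the finite type `E[2]`
  set O' : geomTorsion W ((2 : ℕ) : ℤ) := 0
  set P' : geomTorsion W ((2 : ℕ) : ℤ) := ⟨P, hmem hP⟩
  set Q' : geomTorsion W ((2 : ℕ) : ℤ) := ⟨Q, hmem hQ⟩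
  set S' : geomTorsion W ((2 : ℕ) : ℤ) := ⟨P + Q, hmem (by rw [nsmul_add, hP, hQ, add_zero])⟩
  have hs : ({O', P', Q', S'} : Finset (geomTorsion W ((2 : ℕ) : ℤ))) = Finset.univ := by
    apply Finset.eq_univ_of_card
    rw [← Nat.card_eq_fintype_card, natCard_geomTorsion_eq_sq W h2K]
    have hO'P' : O' ≠ P' := fun h ↦ hP0 (congrArg Subtype.val h).symm
    have hO'Q' : O' ≠ Q' := fun h ↦ hQ0 (congrArg Subtype.val h).symm
    have hO'S' : O' ≠ S' := fun h ↦ hPQ0 (congrArg Subtype.val h).symm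
    have hP'Q' : P' ≠ Q' := fun h ↦ hPQ (congrArg Subtype.val h)
    have hP'S' : P' ≠ S' := fun h ↦ hPQP (congrArg Subtype.val h).symm
    have hQ'S' : Q' ≠ S' := fun h ↦ hPQQ (congrArg Subtype.val h).symm
    rw [Finset.card_insert_of_notMem (by simp [hO'P', hO'Q', hO'S']),
      Finset.card_insert_of_notMem (by simp [hP'Q', hP'S']),
      Finset.card_insert_of_notMem (by simp [hQ'S']), Finset.card_singleton]
    norm_num
  have hT' : (⟨T, hmem hT⟩ : geomTorsion W ((2 : ℕ) : ℤ)) ∈ ({O', P', Q', S'} : Finset _) := by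
    rw [hs]; exact Finset.mem_univ _
  simp only [Finset.mem_insert, Finset.mem_singleton] at hT'
  rcases hT' with h | h | h | h
  · exact Or.inl (congrArg Subtype.val h)
  · exact Or.inr (Or.inl (congrArg Subtype.val h))
  · exact Or.inr (Or.inr (Or.inl (congrArg Subtype.val h)))
  · exact Or.inr (Or.inr (Or.inr (congrArg Subtype.val h)))

end WeierstrassCurve

namespace Literature.NumberTheory.EllipticCurves

open WeierstrassCurve

/-! ### The arithmetic of Kenku's list -/

/-- **No cyclic `4p`-structure in Kenku's list.** If `m ∈ kenkuDegrees`, `p ≥ 5` is prime and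
`4 p m = N²`, then `m = p` and `N = 2p`: `p ∣ N`, so `p ∣ 4m`, `p ∣ m`, `m = p j` with `4 j` a
square, `j = e²`, and `p e² ∈ kenkuDegrees` with `p ≥ 5` only for `e = 1` (the list has no multiple
of `4p, 9p, 16p, 25p`). [cite: SilvermanAEC2009, IX.6 Example 6.4] -/
theorem eq_of_mem_kenkuDegrees_of_four_mul_prime_mul_eq_sq {p m N : ℕ} (hp : p.Prime) (h5 : 5 ≤ p)
    (hm : m ∈ kenkuDegrees) (h : 4 * p * m = N ^ 2) : m = p ∧ N = 2 * p := by
  have hm163 : m ≤ 163 := le_of_mem_kenkuDegrees hm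
  -- `p ∣ N`
  obtain ⟨c, rfl⟩ : p ∣ N := hp.dvd_of_dvd_pow (n := 2) ⟨4 * m, by rw [← h]; ring⟩
  -- `4 m = p c²`
  have h4m : 4 * m = p * c ^ 2 := by
    have : p * (4 * m) = p * (p * c ^ 2) := by rw [← mul_assoc, mul_comm p 4, h]; ring
    exact Nat.eq_of_mul_eq_mul_left hp.pos this
  -- `p ∣ m`
  have hp4 : Nat.Coprime p 4 := by
    rw [show (4 : ℕ) = 2 ^ 2 by norm_num]
    exact (Nat.coprime_primes hp Nat.prime_two |>.2 (by omega)).pow_right 2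
  obtain ⟨j, rfl⟩ : p ∣ m := hp4.dvd_of_dvd_mul_left ⟨c ^ 2, h4m⟩
  -- `4 j = c²`, `j ≤ 32`, `c ≤ 11`
  have h4j : 4 * j = c ^ 2 := by
    have : p * (4 * j) = p * c ^ 2 := by rw [← h4m]; ring
    exact Nat.eq_of_mul_eq_mul_left hp.pos this
  have hj : j ≤ 32 := by nlinarith
  have hc : c ≤ 11 := by nlinarith
  simp only [kenkuDegrees, Finset.mem_union, Finset.mem_Icc, Finset.mem_insert,
    Finset.mem_singleton] at hm
  interval_cases c <;> omega

/-! ### Darmon–Merel 1997, Theorem 2.2, for every curve with full rational `2`-torsion -/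

/-- **Full rational `2`-torsion excludes rational `p`-isogenies for `p ≥ 5` (Darmon–Merel 1997, Thm.
2.2; here from the Mazur–Kenku fact).** Granted `mazurKenku_exists_cyclic_isogeny` (Mazur 1978, Thm.
1 and Kenku 1982: `ℚ`-isogenous elliptic curves are joined by a cyclic `ℚ`-isogeny of degree in `{1,
…, 19, 21, 25, 27, 37, 43, 67, 163}`), let `E/ℚ` be an elliptic curve all of whose `2`-torsion
points in `E(ℚ̄)` are fixed by `Γ_ℚ` (i.e. `E[2] ⊆ E(ℚ)`, "all its points of order `2` defined over
`ℚ`", Darmon–Merel Lemma 1.2 (1)). Then for every prime `p ≥ 5` the mod `p` representation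
`ρ̄_{E,p}` is irreducible (`HasIrreducibleModPGaloisRep`: no `Γ_ℚ`-stable line in `E[p]`, i.e. no
rational `p`-isogeny). Darmon–Merel state this as Thm. 2.2 ("The representation `ρ` is absolutely
irreducible") for their Frey curves and `p ≥ 7`, proving it from Mazur [18] for `p ≥ 17` (an odd
prime of multiplicative reduction) and, for `7 ≤ p ≤ 13`, from the rational points of `X₀(N)`, `N =
14, 22, 26, 21, 33, 39` (cuspidal or CM: Mazur, Kubert, Kenku); the proof given here is a different,
uniform one through `X₀(4p)`: a stable line `C` and the rational `2`-torsion give on `E₁ = E/⟨Q⟩`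
the `Γ_ℚ`-stable cyclic subgroup `⟨g₁ R + g₁ s₀⟩` of order `4p` (`2R = P`, `C = ⟨s₀⟩`), hence a
cyclic `4p`-isogeny `g₂ : E₁ → E₂`, and `4p` divides no Kenku degree — in the tree's existential
form of the fact: a cyclic `ψ : E₁ → E₂` of Kenku degree `m` has `f₂ ψ = [n]`, `4pm = n²`, so `m =
p`, `n = ±2p`, `g₂ [n] = ψ [4p]`, `E₁[2] ⊆ ker g₂` cyclic, absurd. (Irreducibility over `𝔽_p`;
absolute irreducibility, as printed, follows for odd `p` from the oddness of `ρ̄` and is not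
restated here.)
[cite: DarmonMerel1997, Thm. 2.2 (with Lemma 1.2 (1))] -/
theorem hasIrreducibleModPGaloisRep_of_rational_two_torsion_of_mazurKenku
    (hMK : mazurKenku_exists_cyclic_isogeny) (W : WeierstrassCurve ℚ) [W.IsElliptic]
    (h2 : ∀ (σ : Field.absoluteGaloisGroup ℚ) (P : W.geomPoints), 2 • P = 0 → σ • P = P)
    {p : ℕ} (hp : p.Prime) (h5 : 5 ≤ p) : W.HasIrreducibleModPGaloisRep p := by
  haveI : Fact p.Prime := ⟨hp⟩
  haveI : NeZero (p : ℚ) := ⟨Nat.cast_ne_zero.mpr hp.ne_zero⟩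
  have hp2 : p ≠ 2 := by omega
  have hpodd : Odd p := hp.odd_of_ne_two hp2
  by_contra hred
  obtain ⟨H, hHstab, hHcard⟩ :=
    (Mazur1978.not_hasIrreducibleModPGaloisRep_iff_exists_natCard_eq W p).mp hred
  /- Step 1: the stable line as a finite `Γ_ℚ`-stable subgroup `S = ⟨s₀⟩` of `E(ℚ̄)`, order `p`. -/
  set S : AddSubgroup W.geomPoints := H.map (geomTorsion W (p : ℤ)).subtype with hS
  have hScard : Nat.card S = p := by
    rw [← hHcard]
    exact Nat.card_congr (H.equivMapOfInjective _ (geomTorsion W (p : ℤ)).subtype_injective).symm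
  have hSstab : ∀ (σ : Field.absoluteGaloisGroup ℚ) (P : W.geomPoints),
      P ∈ S → σ • P ∈ S := by
    rintro σ P ⟨Q, hQ, rfl⟩
    exact ⟨σ • Q, hHstab σ Q hQ, rfl⟩
  haveI : Finite S := Nat.finite_of_card_ne_zero (hScard ▸ hp.ne_zero)
  have hSne : S ≠ ⊥ := by
    intro h
    rw [h, AddSubgroup.card_bot] at hScard
    exact hp.one_lt.ne hScard
  obtain ⟨⟨s₀, hs₀S⟩, hs₀⟩ := AddSubgroup.ne_bot_iff_exists_ne_zero.1 hSne
  have hs₀0 : s₀ ≠ 0 := fun h0 ↦ hs₀ (Subtype.ext h0)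
  have hps₀ : p • s₀ = 0 := by
    have h0 : Nat.card S • (⟨s₀, hs₀S⟩ : S) = 0 := card_nsmul_eq_zero'
    rw [hScard] at h0
    have := congrArg Subtype.val h0
    rwa [AddSubmonoidClass.coe_nsmul] at this
  have hord₀ : addOrderOf s₀ = p := addOrderOf_eq_prime hps₀ hs₀0
  have hSeq : S = AddSubgroup.zmultiples s₀ := by
    symm
    apply AddSubgroup.eq_of_le_of_card_ge (AddSubgroup.zmultiples_le.2 hs₀S)
    rw [hScard, Nat.card_zmultiples, hord₀]
  /- Step 2: two independent rational `2`-torsion points `P, Q`, and `E[2] = {O, P, Q, P + Q}`. -/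
  have h2K : ((2 : ℕ) : ℚ) ≠ 0 := by norm_num
  haveI : Finite (geomTorsion W ((2 : ℕ) : ℤ)) := finite_geomTorsion_natCast W two_ne_zero
  obtain ⟨P, Q, hP2, hQ2, hP0, hQ0, hPQ⟩ :
      ∃ P Q : W.geomPoints, 2 • P = 0 ∧ 2 • Q = 0 ∧ P ≠ 0 ∧ Q ≠ 0 ∧ P ≠ Q := by
    haveI : Fintype (geomTorsion W ((2 : ℕ) : ℤ)) := Fintype.ofFinite _
    have h3 : 2 < Fintype.card (geomTorsion W ((2 : ℕ) : ℤ)) := by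
      rw [← Nat.card_eq_fintype_card, natCard_geomTorsion_eq_sq W h2K]; norm_num
    obtain ⟨a, b, c, hab, hac, hbc⟩ := Fintype.two_lt_card_iff.1 h3
    have mem2 : ∀ x : geomTorsion W ((2 : ℕ) : ℤ), 2 • (x : W.geomPoints) = 0 := fun x ↦
      AddSubgroup.torsionBy.nsmul_iff.1 x.2
    have hne : ∀ {x y : geomTorsion W ((2 : ℕ) : ℤ)}, x ≠ y → (x : W.geomPoints) ≠ y :=
      fun hxy h ↦ hxy (Subtype.ext h)
    by_cases ha : (a : W.geomPoints) = 0
    · refine ⟨b, c, mem2 b, mem2 c, fun hb ↦ hne hab (ha.trans hb.symm), fun hc ↦ hne hac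
        (ha.trans hc.symm), hne hbc⟩
    · by_cases hb : (b : W.geomPoints) = 0
      · exact ⟨a, c, mem2 a, mem2 c, ha, fun hc ↦ hne hbc (hb.trans hc.symm), hne hac⟩
      · exact ⟨a, b, mem2 a, mem2 b, ha, hb, hne hab⟩
  have hE2 : ∀ {T : W.geomPoints}, 2 • T = 0 → T = 0 ∨ T = P ∨ T = Q ∨ T = P + Q :=
    fun hT ↦ W.eq_zero_or_eq_or_eq_add_of_two_nsmul_eq_zero two_ne_zero hP2 hQ2 hP0 hQ0 hPQ hT
  -- Galois commutes with multiplication by integers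
  have hsm : ∀ (V : WeierstrassCurve ℚ) (σ : Field.absoluteGaloisGroup ℚ) (k : ℤ)
      (X : V.geomPoints), σ • (k • X) = k • σ • X :=
    fun V σ k X ↦ smul_comm σ k X
  have hsmn : ∀ (V : WeierstrassCurve ℚ) (σ : Field.absoluteGaloisGroup ℚ) (k : ℕ)
      (X : V.geomPoints), σ • (k • X) = k • σ • X :=
    fun V σ k X ↦ smul_comm σ k X
  -- a half `R` of `P`
  obtain ⟨R, hR⟩ : ∃ R : W.geomPoints, ((2 : ℕ) : ℤ) • R = P :=
    (W.baseChange (AlgebraicClosure ℚ)).zsmul_surjective_of_isAlgClosed (by norm_num) P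
  rw [natCast_zsmul] at hR
  /- Step 3: the `2`-isogeny `g₁ : E → E₁ = E/⟨Q⟩`. -/
  set CQ : AddSubgroup W.geomPoints := AddSubgroup.zmultiples Q with hCQ
  have hordQ : addOrderOf Q = 2 := addOrderOf_eq_prime hQ2 hQ0
  have hCQcard : Nat.card CQ = 2 := by rw [Nat.card_zmultiples, hordQ]
  have hCQfin : (CQ : Set W.geomPoints).Finite := by
    have h : Nat.card CQ ≠ 0 := by rw [hCQcard]; decide
    exact Nat.finite_of_card_ne_zero h
  have hCQstab : ∀ (σ : Field.absoluteGaloisGroup ℚ) (X : W.geomPoints), X ∈ CQ → σ • X ∈ CQ := by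
    intro σ X hX
    rw [AddSubgroup.mem_zmultiples_iff] at hX
    obtain ⟨k, rfl⟩ := hX
    rw [hsm W σ k Q, h2 σ Q hQ2]
    exact AddSubgroup.zsmul_mem _ (AddSubgroup.mem_zmultiples Q) k
  obtain ⟨E₁, hE₁, g₁, -, hker₁, -, -⟩ :=
    W.exists_isogeny_ker_eq_and_comp_eq_nsmul_holds CQ hCQfin hCQstab
  haveI := hE₁
  have hg₁Q : g₁ Q = 0 := by
    have : Q ∈ g₁.toAddMonoidHom.ker := hker₁ ▸ AddSubgroup.mem_zmultiples Q
    exact this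
  have hCQmem : ∀ X : W.geomPoints, X ∈ CQ → X = 0 ∨ X = Q := by
    intro X hX
    rw [AddSubgroup.mem_zmultiples_iff] at hX
    obtain ⟨k, rfl⟩ := hX
    rcases Int.even_or_odd k with ⟨j, rfl⟩ | ⟨j, rfl⟩
    · left
      rw [add_zsmul, ← zsmul_add, ← two_nsmul, hQ2, zsmul_zero]
    · right
      rw [add_zsmul, one_zsmul, add_eq_right, two_mul, add_zsmul, ← zsmul_add, ← two_nsmul, hQ2,
        zsmul_zero]
  have hg₁ker : ∀ X : W.geomPoints, g₁ X = 0 → X = 0 ∨ X = Q := fun X hX ↦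
    hCQmem X (by rw [← hker₁]; exact hX)
  have hg₁P : g₁ P ≠ 0 := fun h ↦ by
    rcases hg₁ker P h with h' | h'
    · exact hP0 h'
    · exact hPQ h'
  have hg₁s₀ : g₁ s₀ ≠ 0 := fun h ↦ by
    rcases hg₁ker s₀ h with h' | h'
    · exact hs₀0 h'
    · have hdvd : addOrderOf s₀ ∣ 2 := addOrderOf_dvd_iff_nsmul_eq_zero.2 (by rw [h']; exact hQ2)
      rw [hord₀] at hdvd
      have := Nat.le_of_dvd two_pos hdvd
      omega
  /- Step 4: the cyclic `Γ_ℚ`-stable subgroup `K = ⟨κ⟩`, `κ = g₁ R + g₁ s₀`, of order `4p`. -/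
  set x : E₁.geomPoints := g₁ R with hx
  set y : E₁.geomPoints := g₁ s₀ with hy
  have h2x : 2 • x = g₁ P := by rw [hx, ← map_nsmul, hR]
  have h4x : 4 • x = 0 := by
    rw [show (4 : ℕ) = 2 * 2 by norm_num, ← smul_smul, h2x, ← map_nsmul, hP2, map_zero]
  have hordx : addOrderOf x = 4 := by
    have e := addOrderOf_eq_prime_pow (p := 2) (n := 1) (x := x)
      (by rw [pow_one, h2x]; exact hg₁P) (by norm_num; exact h4x)
    norm_num at e
    exact e
  have hpy : p • y = 0 := by rw [hy, ← map_nsmul, hps₀, map_zero]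
  have hordy : addOrderOf y = p := addOrderOf_eq_prime hpy hg₁s₀
  have hcop : Nat.Coprime 4 p := by
    have e := ((Nat.coprime_primes Nat.prime_two hp).2 (Ne.symm hp2)).pow_left 2
    norm_num at e
    exact e
  have h4p0 : 4 * p ≠ 0 := by omega
  set κ : E₁.geomPoints := x + y with hκ
  have hordκ : addOrderOf κ = 4 * p := by
    rw [hκ, (AddCommute.all x y).addOrderOf_add_eq_mul_addOrderOf_of_coprime
      (by rw [hordx, hordy]; exact hcop), hordx, hordy]
  set Ks : AddSubgroup E₁.geomPoints := AddSubgroup.zmultiples κ with hKs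
  have hKcard : Nat.card Ks = 4 * p := by rw [Nat.card_zmultiples, hordκ]
  have hKfin : (Ks : Set E₁.geomPoints).Finite := by
    have h : Nat.card Ks ≠ 0 := by rw [hKcard]; exact h4p0
    exact Nat.finite_of_card_ne_zero h
  have hκK : κ ∈ Ks := AddSubgroup.mem_zmultiples κ
  have hxK : x ∈ Ks := by
    -- `x = (p * p) • κ` since `p² ≡ 1 (mod 4)` and `p • y = 0`
    obtain ⟨t, ht⟩ := hpodd
    have hppx : (p * p) • x = x := by
      have e : p * p = (t * t + t) * 4 + 1 := by rw [ht]; ring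
      rw [e, add_nsmul, one_nsmul, ← smul_smul, h4x, smul_zero, zero_add]
    have hppy : (p * p) • y = 0 := by rw [← smul_smul, hpy, smul_zero]
    have e : (p * p) • κ = x := by rw [hκ, nsmul_add, hppx, hppy, add_zero]
    rw [← e]
    exact Ks.nsmul_mem hκK _
  have hyK : y ∈ Ks := by
    have e : y = κ - x := by rw [hκ, add_sub_cancel_left]
    rw [e]
    exact Ks.sub_mem hκK hxK
  -- images under `g₁` of the `2`-torsion and of `S` lie in `K`
  have hPQ0 : g₁ (P + Q) = 2 • x := by rw [map_add, hg₁Q, add_zero, h2x]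
  have hg₁2 : ∀ {T : W.geomPoints}, 2 • T = 0 → g₁ T ∈ Ks := by
    intro T hT
    rcases hE2 hT with rfl | rfl | rfl | rfl
    · rw [map_zero]; exact Ks.zero_mem
    · rw [← h2x]; exact Ks.nsmul_mem hxK 2
    · rw [hg₁Q]; exact Ks.zero_mem
    · rw [hPQ0]; exact Ks.nsmul_mem hxK 2
  have hg₁S : ∀ {s : W.geomPoints}, s ∈ S → g₁ s ∈ Ks := by
    intro s hs
    rw [hSeq, AddSubgroup.mem_zmultiples_iff] at hs
    obtain ⟨k, rfl⟩ := hs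
    rw [map_zsmul]
    exact Ks.zsmul_mem hyK k
  have hKstab : ∀ (σ : Field.absoluteGaloisGroup ℚ) (X : E₁.geomPoints), X ∈ Ks → σ • X ∈ Ks := by
    intro σ X hX
    rw [AddSubgroup.mem_zmultiples_iff] at hX
    obtain ⟨k, rfl⟩ := hX
    rw [hsm E₁ σ k κ]
    refine Ks.zsmul_mem ?_ k
    have hσR : 2 • (σ • R - R) = 0 := by
      rw [nsmul_sub, ← hsmn W σ 2 R, hR, h2 σ P hP2, sub_self]
    have e : σ • κ = g₁ (σ • R - R) + x + g₁ (σ • s₀) := by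
      rw [hκ, smul_add, hx, hy, ← g₁.map_smul, ← g₁.map_smul, map_sub, sub_add_cancel]
    rw [e]
    exact Ks.add_mem (Ks.add_mem (hg₁2 hσR) hxK) (hg₁S (hSstab σ s₀ hs₀S))
  /- Step 5: the cyclic `4p`-isogeny `g₂ : E₁ → E₂ = E₁/K`; the fact; `f₂ ψ = [n]`, `4pm = n²`. -/
  obtain ⟨E₂, hE₂, g₂, f₂, hker₂, hfg₂, -⟩ :=
    E₁.exists_isogeny_ker_eq_and_comp_eq_nsmul_holds Ks hKfin hKstab
  haveI := hE₂
  obtain ⟨ψ, -, hψK⟩ := hMK E₁ E₂ ⟨g₂⟩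
  obtain ⟨n, hn⟩ :
      ∃ n : ℤ, @Eq (AddMonoid.End E₁.geomPoints) (f₂.comp ψ).toAddMonoidHom n := by
    by_contra hne
    push Not at hne
    exact WeierstrassCurve.not_hasRationalCM_holds E₁
      ⟨_, (f₂.comp ψ).toAddMonoidHom_mem_endRing, hne⟩
  have hχ : ∀ X, f₂ (ψ X) = n • X := fun X ↦ by
    have := DFunLike.congr_fun hn X
    rw [AddMonoid.End.intCast_apply] at this
    exact this
  have h1 : Nat.card (f₂.comp ψ).toAddMonoidHom.ker =
      Nat.card f₂.toAddMonoidHom.ker * ψ.degree :=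
    AddMonoidHom.natCard_ker_comp_of_surjective f₂.toAddMonoidHom ψ.toAddMonoidHom ψ.surjective
  have h2' : Nat.card (f₂.comp g₂).toAddMonoidHom.ker =
      Nat.card f₂.toAddMonoidHom.ker * (4 * p) := by
    have e := AddMonoidHom.natCard_ker_comp_of_surjective f₂.toAddMonoidHom g₂.toAddMonoidHom
      g₂.surjective
    rw [hker₂, hKcard] at e
    exact e
  have h4pQ : ((4 * p : ℕ) : ℚ) ≠ 0 := by exact_mod_cast h4p0
  have hfg' : (f₂.comp g₂).toAddMonoidHom.ker = geomTorsion E₁ ((4 * p : ℕ) : ℤ) := by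
    ext X
    rw [AddMonoidHom.mem_ker, Isogeny.coe_toAddMonoidHom, Isogeny.comp_apply, hfg₂, hKcard,
      AddSubgroup.torsionBy.nsmul_iff]
  have hf₂card : Nat.card f₂.toAddMonoidHom.ker = 4 * p := by
    have e := h2'
    rw [hfg', natCard_geomTorsion_eq_sq E₁ h4pQ, sq] at e
    exact (Nat.eq_of_mul_eq_mul_right (by omega) e).symm
  have hn0 : n ≠ 0 := by
    rintro rfl
    have hker0 : (f₂.comp ψ).toAddMonoidHom.ker = ⊤ := by
      ext X
      simp only [AddMonoidHom.mem_ker, Isogeny.coe_toAddMonoidHom, Isogeny.comp_apply, hχ,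
        zero_smul, AddSubgroup.mem_top]
    have e := h1
    rw [hker0, AddSubgroup.card_top, Nat.card_eq_zero_of_infinite, hf₂card] at e
    exact (mul_pos (by omega) ψ.degree_pos).ne' e.symm
  have hχker : (f₂.comp ψ).toAddMonoidHom.ker = geomTorsion E₁ n := by
    ext X
    rw [AddMonoidHom.mem_ker, Isogeny.coe_toAddMonoidHom, Isogeny.comp_apply, hχ]
    rfl
  have key : 4 * p * ψ.degree = n.natAbs ^ 2 := by
    rw [← hf₂card, ← h1, hχker, natCard_geomTorsion_int_eq_sq E₁ hn0]
  obtain ⟨-, hN⟩ := eq_of_mem_kenkuDegrees_of_four_mul_prime_mul_eq_sq hp h5 hψK key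
  /- Step 6: `g₂ ∘ [n] = ψ ∘ [4p]` (difference killed by `f₂`, `E₁(ℚ̄)` divisible), so
  `E₁[2] ⊆ ker g₂ = K` as `n = ±2p`. -/
  have hδ : ∀ X : E₁.geomPoints, g₂ (n • X) = ψ (((4 * p : ℕ) : ℤ) • X) := by
    set δ : E₁.geomPoints →+ E₂.geomPoints :=
      g₂.toAddMonoidHom.comp (zsmulAddGroupHom n) -
        ψ.toAddMonoidHom.comp (zsmulAddGroupHom ((4 * p : ℕ) : ℤ)) with hδdef
    have hδapply : ∀ X, δ X = g₂ (n • X) - ψ (((4 * p : ℕ) : ℤ) • X) := fun X ↦ rfl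
    have hδF : ∀ X, δ X ∈ f₂.toAddMonoidHom.ker := fun X ↦ by
      rw [AddMonoidHom.mem_ker, hδapply, Isogeny.coe_toAddMonoidHom, map_sub, hfg₂, hχ, hKcard,
        natCast_zsmul, smul_comm n (4 * p) X, sub_self]
    have hdiv : Function.Surjective fun X : E₁.geomPoints =>
        (Nat.card f₂.toAddMonoidHom.ker : ℤ) • X := by
      rw [hf₂card]
      exact (E₁.baseChange (AlgebraicClosure ℚ)).zsmul_surjective_of_isAlgClosed
        (by exact_mod_cast h4p0)
    have hδ0 := δ.eq_zero_of_forall_mem_of_zsmul_surjective _ hδF hdiv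
    intro X
    have e := DFunLike.congr_fun hδ0 X
    rw [hδapply, AddMonoidHom.zero_apply, sub_eq_zero] at e
    exact e
  have hE₁2 : ∀ T : E₁.geomPoints, 2 • T = 0 → T ∈ Ks := by
    intro T hT
    have h2p0 : ((2 * p : ℕ) : ℤ) ≠ 0 := by exact_mod_cast (by omega : 2 * p ≠ 0)
    obtain ⟨X, hX⟩ : ∃ X : E₁.geomPoints, ((2 * p : ℕ) : ℤ) • X = T :=
      (E₁.baseChange (AlgebraicClosure ℚ)).zsmul_surjective_of_isAlgClosed h2p0 T
    have h4pX : ((4 * p : ℕ) : ℤ) • X = 0 := by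
      rw [show ((4 * p : ℕ) : ℤ) = ((2 : ℕ) : ℤ) * ((2 * p : ℕ) : ℤ) by push_cast; ring,
        ← smul_smul, hX, natCast_zsmul, hT]
    have hnX : n • X ∈ Ks := by
      rw [← hker₂, AddMonoidHom.mem_ker, Isogeny.coe_toAddMonoidHom, hδ X, h4pX, map_zero]
    have hnT : n • X = T ∨ n • X = -T := by
      rcases Int.natAbs_eq n with h | h
      · left; rw [h, hN, hX]
      · right; rw [h, hN, neg_zsmul, hX]
    rcases hnT with h | h
    · rw [← h]; exact hnX
    · rw [← neg_neg T, ← h]; exact Ks.neg_mem hnX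
  /- Step 7: contradiction — `E₁[2]`, of order `4` and killed by `2`, inside the cyclic `K`. -/
  haveI : Finite (geomTorsion E₁ ((2 : ℕ) : ℤ)) := finite_geomTorsion_natCast E₁ two_ne_zero
  have hle : geomTorsion E₁ ((2 : ℕ) : ℤ) ≤ Ks := fun T hT ↦
    hE₁2 T (AddSubgroup.torsionBy.nsmul_iff.1 hT)
  haveI hcyc : IsAddCyclic (geomTorsion E₁ ((2 : ℕ) : ℤ)) :=
    isAddCyclic_of_injective (AddSubgroup.inclusion hle) (AddSubgroup.inclusion_injective hle)
  have hexp : AddMonoid.exponent (geomTorsion E₁ ((2 : ℕ) : ℤ)) ∣ 2 :=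
    AddMonoid.exponent_dvd_of_forall_nsmul_eq_zero fun T ↦ Subtype.ext (by
      rw [AddSubmonoidClass.coe_nsmul]
      exact AddSubgroup.torsionBy.nsmul_iff.1 T.2)
  rw [IsAddCyclic.exponent_eq_card, natCard_geomTorsion_eq_sq E₁ h2K] at hexp
  have := Nat.le_of_dvd two_pos hexp
  norm_num at this

/-! ### Frey–Hellegouarch curves (Darmon–Merel 1997, Lemma 1.2 (1) and Thm. 2.2) -/

/-- **The `2`-torsion of a Frey–Hellegouarch curve is rational** (Darmon–Merel 1997, Lemma 1.2 (1):
"the curve `E` has all its points of order `2` defined over `ℚ`"): for `y² = x(x − A)(x + B)` with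
`A B (A + B) ≠ 0`, every `T ∈ E(ℚ̄)` with `2T = O` is fixed by `Γ_ℚ` — indeed `E[2]` consists of
`O, (0, 0), (A, 0)` and their sum (`eq_zero_or_eq_or_eq_add_of_two_nsmul_eq_zero`), points with
rational coordinates.
[cite: DarmonMerel1997, Lemma 1.2 (1)] -/
theorem smul_eq_of_two_nsmul_eq_zero_freyCurve {A B : ℤ} (h0 : A * B * (A + B) ≠ 0)
    (σ : Field.absoluteGaloisGroup ℚ) {T : (freyCurve A B).geomPoints} (hT : 2 • T = 0) :
    σ • T = T := by
  haveI := isElliptic_freyCurve h0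
  have hA0 : (A : ℚ) ≠ 0 := by
    have h : A ≠ 0 := by rintro rfl; simp at h0
    exact_mod_cast h
  -- the rational points `(r, 0)`, `r ∈ {0, A}`, as geometric points
  have hnsQ : ∀ r : ℚ, r = 0 ∨ r = A → (freyCurve A B).toAffine.Nonsingular r 0 := by
    intro r hr
    have heq : (freyCurve A B).toAffine.Equation r 0 := by
      rw [Affine.equation_iff]
      simp only [toAffine, freyCurve]
      rcases hr with rfl | rfl <;> ring
    exact Affine.equation_iff_nonsingular.mp heq
  have hns : ∀ r : ℚ, r = 0 ∨ r = A →
      ((freyCurve A B).baseChange (AlgebraicClosure ℚ)).toAffine.Nonsingular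
        (algebraMap ℚ (AlgebraicClosure ℚ) r) 0 := by
    intro r hr
    have h := (Affine.map_nonsingular (freyCurve A B).toAffine
      (algebraMap ℚ (AlgebraicClosure ℚ)).injective r 0).mpr (hnsQ r hr)
    rwa [map_zero] at h
  set X : ∀ r : ℚ, r = 0 ∨ r = A → (freyCurve A B).geomPoints :=
    fun r hr ↦ Affine.Point.some _ _ (hns r hr) with hX
  have hfix : ∀ (r : ℚ) (hr : r = 0 ∨ r = A), σ • X r hr = X r hr := by
    intro r hr
    change Affine.Point.map
      ((show AlgebraicClosure ℚ ≃ₐ[ℚ] AlgebraicClosure ℚ from σ) :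
        AlgebraicClosure ℚ →ₐ[ℚ] AlgebraicClosure ℚ) (Affine.Point.some _ _ (hns r hr)) = _
    rw [Affine.Point.map_some]
    simp only [hX, AlgHom.commutes, map_zero]
    rfl
  have h2X : ∀ (r : ℚ) (hr : r = 0 ∨ r = A), 2 • X r hr = 0 := by
    intro r hr
    rw [two_nsmul]
    exact Affine.Point.add_self_of_Y_eq (by simp [Affine.negY, toAffine, freyCurve])
  have hX0 : ∀ (r : ℚ) (hr : r = 0 ∨ r = A), X r hr ≠ 0 := fun r hr ↦ Affine.Point.some_ne_zero _
  have hne : X 0 (Or.inl rfl) ≠ X A (Or.inr rfl) := by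
    intro h
    simp only [hX] at h
    exact hA0 ((algebraMap ℚ (AlgebraicClosure ℚ)).injective (Affine.Point.some.inj h).1).symm
  rcases (freyCurve A B).eq_zero_or_eq_or_eq_add_of_two_nsmul_eq_zero two_ne_zero
      (h2X 0 (Or.inl rfl)) (h2X A (Or.inr rfl)) (hX0 0 (Or.inl rfl)) (hX0 A (Or.inr rfl)) hne hT
      with rfl | rfl | rfl | rfl
  · exact smul_zero σ
  · exact hfix 0 (Or.inl rfl)
  · exact hfix A (Or.inr rfl)
  · rw [smul_add, hfix 0 (Or.inl rfl), hfix A (Or.inr rfl)]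

/-- **Darmon–Merel 1997, Thm. 2.2, for every Frey–Hellegouarch curve and every prime `p ≥ 5`, from
the Mazur–Kenku fact**: granted `mazurKenku_exists_cyclic_isogeny`, for integers `A, B` with
`A B (A + B) ≠ 0` the mod `p` Galois representation of `y² = x(x − A)(x + B)` is irreducible for
every prime `p ≥ 5` (Darmon–Merel: their curves (4), `A = aᵖ`, `B = −2cᵖ`, `p ≥ 7`; the same holds
for Frey's curve of a Fermat triple). [cite: DarmonMerel1997, Thm. 2.2] -/
theorem hasIrreducibleModPGaloisRep_freyCurve_of_mazurKenku (hMK : mazurKenku_exists_cyclic_isogeny)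
    {A B : ℤ} (h0 : A * B * (A + B) ≠ 0) {p : ℕ} (hp : p.Prime) (h5 : 5 ≤ p) :
    (freyCurve A B).HasIrreducibleModPGaloisRep p :=
  haveI := isElliptic_freyCurve h0
  hasIrreducibleModPGaloisRep_of_rational_two_torsion_of_mazurKenku hMK (freyCurve A B)
    (fun σ _ hT ↦ smul_eq_of_two_nsmul_eq_zero_freyCurve h0 σ hT) hp h5

end Literature.NumberTheory.EllipticCurves
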